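import Mathlib.NumberTheory.Padics.Complex
import Mathlib.Analysis.Normed.Group.Ultra
import Mathlib.Algebra.Polynomial.Roots
import Mathlib.FieldTheory.IsAlgClosed.Basic
import HarnessLib

set_option linter.dupNamespace false -- `Summit.BirchSwinnertonDyer.BirchSwinnertonDyer.Theorems.…` (summit = sub)
set_option autoImplicit false

/-!
# Route `CongruentShaFreeCut` (rung S2) — LEMMA R∞, polynomial step, part 1: the `p`-power map
# `Φ = (1+X)^p − 1` CONTRACTS the punctured open unit disc of `ℂ_p`, and `Q ↦ Q(Φ)` preserves the
# multiplicity of the root `0`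

Cell `bsd-cn100`, prover seat `bsd-cn100-transfer` (g11), plan g15 RULING-4 (2026-08-27T01:22:06Z)
«COMMISSIONED … LEMMA R∞ (series rigidity across periods)», file 2 (pure polynomial algebra over `ℂ_p`).
Supports, does not close, stmt-BirchSwinnertonDyer-19079. THEOREMS ONLY; imports no `Theses` module and no
project file. PARTITION: none — RANK axis. HONEST FRAMING: elementary; nothing about BSD.

WHY. Two ♯-frames `𝓛, 𝓛'` of `IsBDPLFunctionUpTo` for the same `(ι, 𝔭, κ, γ, f)` satisfy the POWER-TYPE
functional equation `θ · 𝓛'(Φ) · 𝓛^p = 𝓛'^p · 𝓛(Φ)`, `Φ(X) = (1+X)^p − 1` (file 3); after `p`-content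
extraction and Weierstrass preparation in `R₀⟦T⟧` (file 1) its polynomial shadow is `P'(Φ)·P^p = P'^p·P(Φ)`
for the distinguished polynomials of `𝓛, 𝓛'` (roots in the open unit disc of `ℂ_p`). THIS FILE: that
identity forces `P = P'`. The purely algebraic statement is FALSE (`Q₁ = 1, Q₂ = (X+1)^n`; in characteristic
`p` every `Q`): the proof uses the `p`-adic CONTRACTION `‖(1+x)^p − 1‖ < ‖x‖` on the punctured open disc and
descends on a root of MINIMAL absolute value (shown to be a common root), after matching the multiplicities
of the root `0`. The LINEAR shape `P'·(P∘Φ) = P·(P'∘Φ)` of b2b-bsdres's cyclotomic tuple rigidity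
(`…Rank1Residual.Additive.eq_of_mul_comp_eq_mul_comp`) does not cover this power-type shape.

* §1 `normPowerMapEval_lt` — `‖(1+x)^p − 1‖ < ‖x‖ for `0 < ‖x‖ < 1` in `ℂ_p`.
* §2 `rootMultiplicity_zero_comp_powerMap` — the multiplicity of the root `0` is unchanged by `Q ↦ Q(Φ)`;
  `rootMultiplicity_zero_eq_of_identity` — under `Q₂(Φ)Q₁^p = Q₂^pQ₁(Φ)` the root `0` has equal multiplicity.
The rigidity statement itself (`eq_of_comp_powerMap_mul_pow_eq`) is part 2,
`CongruentShaFreeCutPowerMapPolynomialRigidity.lean`.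

References: [Washington1997] §7.1–7.2 (the `p`-power map on `Λ`); [Cassels1986] Ch. 4 (ultrametric
estimates).
-/

noncomputable section

open scoped Classical

open Polynomial

namespace Summit.BirchSwinnertonDyer.BirchSwinnertonDyer.Theorems.CongruentShaFreeCutPowerMapPolynomialRigidity

variable {p : ℕ} [hp : Fact p.Prime]

/-! ### §1 The `p`-power map contracts the punctured open unit disc of `ℂ_p` -/

/-- The polynomial `E_p(X) = ∑_{j<p} (1+X)^j` with `X · E_p(X) = (1+X)^p − 1` (geometric sum). [folklore] -/
theorem X_mul_geom_sum_eq (K : Type*) [CommRing K] (n : ℕ) :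
    (X : K[X]) * ∑ j ∈ Finset.range n, (1 + X : K[X]) ^ j = (1 + X) ^ n - 1 := by
  have h := geom_sum_mul (1 + X : K[X]) n
  rw [add_sub_cancel_left] at h
  rw [mul_comm]
  exact h

/-- `E_p(0) = p`. [folklore] -/
theorem eval_zero_geom_sum (K : Type*) [CommRing K] (n : ℕ) :
    (∑ j ∈ Finset.range n, (1 + X : K[X]) ^ j).eval 0 = n := by
  simp [eval_finsetSum]

/-- `‖E_p(x)‖ < 1` for `‖x‖ < 1`: `E_p(x) = p + ∑_{j<p} ((1+x)^j − 1)` with `‖p‖ < 1` and each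
`‖(1+x)^j − 1‖ ≤ ‖x‖ < 1`. [folklore] -/
theorem norm_eval_geom_sum_sub_lt_one {x : ℂ_[p]} (hx : ‖x‖ < 1) :
    ‖(∑ j ∈ Finset.range p, (1 + X : ℂ_[p][X]) ^ j).eval x‖ < 1 := by
  -- `E_p(x) = p + ∑_{j<p} ((1+x)^j - 1)` and each `(1+x)^j - 1` has norm `≤ ‖x‖ < 1`, `‖p‖ < 1`.
  have hx1 : ‖x‖ ≤ 1 := hx.le
  have hterm : ∀ j : ℕ, ‖((1 : ℂ_[p]) + x) ^ j - 1‖ ≤ ‖x‖ := by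
    intro j
    induction j with
    | zero => simp
    | succ j ih =>
      have : ((1 : ℂ_[p]) + x) ^ (j + 1) - 1 = (((1 : ℂ_[p]) + x) ^ j - 1) * (1 + x) + x := by ring
      rw [this]
      calc ‖(((1 : ℂ_[p]) + x) ^ j - 1) * (1 + x) + x‖
          ≤ max ‖(((1 : ℂ_[p]) + x) ^ j - 1) * (1 + x)‖ ‖x‖ := IsUltrametricDist.norm_add_le_max _ _
        _ ≤ max ‖x‖ ‖x‖ := by
            gcongr
            rw [norm_mul]
            calc ‖((1 : ℂ_[p]) + x) ^ j - 1‖ * ‖(1 : ℂ_[p]) + x‖ ≤ ‖x‖ * 1 := by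
                  gcongr
                  calc ‖(1 : ℂ_[p]) + x‖ ≤ max ‖(1 : ℂ_[p])‖ ‖x‖ := IsUltrametricDist.norm_add_le_max _ _
                    _ ≤ 1 := max_le (by simp) hx1
              _ = ‖x‖ := mul_one _
        _ = ‖x‖ := max_self _
  have hsum : (∑ j ∈ Finset.range p, (1 + X : ℂ_[p][X]) ^ j).eval x =
      (p : ℂ_[p]) + ∑ j ∈ Finset.range p, (((1 : ℂ_[p]) + x) ^ j - 1) := by
    rw [eval_finsetSum]
    simp only [eval_pow, eval_add, eval_one, eval_X, Finset.sum_sub_distrib, Finset.sum_const,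
      Finset.card_range, nsmul_eq_mul, mul_one]
    ring
  rw [hsum]
  have hpn : ‖(p : ℂ_[p])‖ < 1 := by
    rw [← map_natCast (algebraMap ℚ_[p] ℂ_[p]) p, norm_algebraMap', Padic.norm_p]
    exact inv_lt_one_of_one_lt₀ (by exact_mod_cast hp.out.one_lt)
  calc ‖(p : ℂ_[p]) + ∑ j ∈ Finset.range p, (((1 : ℂ_[p]) + x) ^ j - 1)‖
      ≤ max ‖(p : ℂ_[p])‖ ‖∑ j ∈ Finset.range p, (((1 : ℂ_[p]) + x) ^ j - 1)‖ :=
        IsUltrametricDist.norm_add_le_max _ _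
    _ < 1 := by
        refine max_lt hpn ?_
        calc ‖∑ j ∈ Finset.range p, (((1 : ℂ_[p]) + x) ^ j - 1)‖ ≤ ‖x‖ :=
              IsUltrametricDist.norm_sum_le_of_forall_le_of_nonneg (norm_nonneg x) fun j _ ↦ hterm j
          _ < 1 := hx

/-- **The `p`-power map contracts the punctured open unit disc**: for `x ∈ ℂ_p` with `0 < ‖x‖ < 1`,
`‖(1+x)^p − 1‖ < ‖x‖` (`(1+x)^p − 1 = x · E_p(x)` with `‖E_p(x)‖ < 1`). [cite: Washington1997, §7.2 (the p-power map T ↦ (1+T)^p − 1)] -/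
theorem normPowerMapEval_lt {x : ℂ_[p]} (hx0 : x ≠ 0) (hx : ‖x‖ < 1) :
    ‖((1 + X : ℂ_[p][X]) ^ p - 1).eval x‖ < ‖x‖ := by
  rw [← X_mul_geom_sum_eq ℂ_[p] p, eval_mul, eval_X, norm_mul]
  calc ‖x‖ * ‖(∑ j ∈ Finset.range p, (1 + X : ℂ_[p][X]) ^ j).eval x‖ < ‖x‖ * 1 :=
        mul_lt_mul_of_pos_left (norm_eval_geom_sum_sub_lt_one hx) (norm_pos_iff.mpr hx0)
    _ = ‖x‖ := mul_one _

/-! ### §2 The multiplicity of the root `0` is unchanged by `Q ↦ Q(Φ)` -/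

/-- `Φ = (1+X)^p − 1` is `X` times a polynomial with constant term `p ≠ 0`, so its root `0` is simple:
`rootMultiplicity 0 Φ = 1` over `ℂ_p`. [folklore] -/
theorem rootMultiplicity_zero_powerMap :
    rootMultiplicity 0 ((1 + X : ℂ_[p][X]) ^ p - 1) = 1 := by
  have hp0 : (p : ℂ_[p]) ≠ 0 := by exact_mod_cast hp.out.ne_zero
  have hE : (∑ j ∈ Finset.range p, (1 + X : ℂ_[p][X]) ^ j) ≠ 0 := by
    intro h
    have := eval_zero_geom_sum ℂ_[p] p
    rw [h, eval_zero] at this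
    exact hp0 this.symm
  have hΦ : ((1 + X : ℂ_[p][X]) ^ p - 1) ≠ 0 := by
    rw [← X_mul_geom_sum_eq ℂ_[p] p]
    exact mul_ne_zero X_ne_zero hE
  rw [← X_mul_geom_sum_eq ℂ_[p] p] at hΦ ⊢
  have hX : rootMultiplicity 0 (X : ℂ_[p][X]) = 1 := by
    simpa using rootMultiplicity_X_sub_C_self (R := ℂ_[p]) (x := 0)
  have hEr : rootMultiplicity 0 (∑ j ∈ Finset.range p, (1 + X : ℂ_[p][X]) ^ j) = 0 := by
    apply rootMultiplicity_eq_zero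
    rw [IsRoot.def, eval_zero_geom_sum]
    exact hp0
  rw [rootMultiplicity_mul hΦ, hX, hEr]

/-- For `Q ≠ 0`: `rootMultiplicity 0 (Q(Φ)) = rootMultiplicity 0 Q` — write `Q = X^m · Q₁` with
`Q₁(0) ≠ 0`; then `Q(Φ) = Φ^m · Q₁(Φ)` with `Q₁(Φ)(0) = Q₁(0) ≠ 0` and `Φ` has a simple root at `0`.
[folklore] -/
theorem rootMultiplicity_zero_comp_powerMap {Q : ℂ_[p][X]} (hQ : Q ≠ 0) :
    rootMultiplicity 0 (Q.comp ((1 + X : ℂ_[p][X]) ^ p - 1)) = rootMultiplicity 0 Q := by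
  set Φ : ℂ_[p][X] := (1 + X : ℂ_[p][X]) ^ p - 1 with hΦdef
  obtain ⟨Q₁, hQ₁, hndvd⟩ := exists_eq_pow_rootMultiplicity_mul_and_not_dvd Q hQ 0
  set m := rootMultiplicity 0 Q with hm
  have hQ₁0 : Q₁.eval 0 ≠ 0 := by
    intro h
    apply hndvd
    rw [map_zero, sub_zero]
    exact X_dvd_iff.mpr (by rwa [coeff_zero_eq_eval_zero])
  have hQ₁ne : Q₁ ≠ 0 := fun h ↦ hQ₁0 (by rw [h, eval_zero])
  have hΦ0 : Φ.eval 0 = 0 := by simp [hΦdef]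
  have hΦne : Φ ≠ 0 := by
    intro h
    have h1 := rootMultiplicity_zero_powerMap (p := p)
    rw [← hΦdef, h, rootMultiplicity_zero] at h1
    exact zero_ne_one h1
  have hdegΦ : 0 < Φ.natDegree := by
    by_contra h
    push Not at h
    have h0 : Φ.natDegree = 0 := Nat.le_zero.mp h
    obtain ⟨c, hc⟩ := natDegree_eq_zero.mp h0
    have : Φ.eval 0 = c := by rw [← hc, eval_C]
    rw [hΦ0] at this
    apply hΦne
    rw [← hc, ← this, map_zero]
  -- `Q.comp Φ = Φ^m * Q₁.comp Φ`
  have hcomp : Q.comp Φ = Φ ^ m * Q₁.comp Φ := by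
    conv_lhs => rw [hQ₁]
    rw [map_zero, sub_zero, mul_comp, pow_comp, X_comp]
  have hQ₁c0 : (Q₁.comp Φ).eval 0 ≠ 0 := by
    rw [eval_comp, hΦ0]
    exact hQ₁0
  have hQ₁cne : Q₁.comp Φ ≠ 0 := fun h ↦ hQ₁c0 (by rw [h, eval_zero])
  have hpow : Φ ^ m ≠ 0 := pow_ne_zero _ hΦne
  rw [hcomp, rootMultiplicity_mul (mul_ne_zero hpow hQ₁cne)]
  have h1 : rootMultiplicity 0 (Φ ^ m) = m := by
    induction m with
    | zero => simp
    | succ k ih =>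
      rw [pow_succ, rootMultiplicity_mul (mul_ne_zero (pow_ne_zero _ hΦne) hΦne), ih,
        rootMultiplicity_zero_powerMap]
  have h2 : rootMultiplicity 0 (Q₁.comp Φ) = 0 := by
    rw [rootMultiplicity_eq_zero]
    exact hQ₁c0
  rw [h1, h2, add_zero]

/-! ### §3 Auxiliary facts about `Φ` and about roots in the disc (used by part 2) -/

/-- One descent step on a common root: if `Q = (X − α)·R` (i.e. `α` is a root) then
`Q(Φ) = (Φ − α)·R(Φ)`. [folklore] -/
theorem comp_eq_of_isRoot {Q : ℂ_[p][X]} {α : ℂ_[p]} (h : Q.IsRoot α) (Φ : ℂ_[p][X]) :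
    Q.comp Φ = (Φ - C α) * (Q / (X - C α)).comp Φ := by
  conv_lhs => rw [← (mul_div_eq_iff_isRoot (p := Q) (a := α)).mpr h]
  rw [mul_comp, sub_comp, X_comp, C_comp]

/-- Ultrametric bookkeeping: `‖∏_{a ∈ s} (X − a)(0)‖ ≤ 1` when all `‖a‖ < 1`. [folklore] -/
theorem norm_prod_eval_zero_le_one (s : Multiset ℂ_[p]) (hs : ∀ a ∈ s, ‖a‖ < 1) :
    ‖(s.map fun a ↦ (X - C a : ℂ_[p][X]).eval 0).prod‖ ≤ 1 := by
  induction s using Multiset.induction_on with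
  | empty => simp
  | cons a s ih =>
    rw [Multiset.map_cons, Multiset.prod_cons, norm_mul]
    have ha : ‖(X - C a : ℂ_[p][X]).eval 0‖ < 1 := by
      rw [eval_sub, eval_X, eval_C, zero_sub, norm_neg]
      exact hs a (Multiset.mem_cons_self a s)
    have ih' := ih (fun b hb ↦ hs b (Multiset.mem_cons_of_mem hb))
    calc ‖(X - C a : ℂ_[p][X]).eval 0‖ * ‖(s.map fun a ↦ (X - C a : ℂ_[p][X]).eval 0).prod‖
        ≤ 1 * 1 := by gcongr
      _ = 1 := one_mul _

/-- `‖∏_{a ∈ s} (X − a)(0)‖ < 1` when all `‖a‖ < 1` and `s ≠ 0`. [folklore] -/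
theorem norm_prod_eval_zero_lt_one {s : Multiset ℂ_[p]} (hs : ∀ a ∈ s, ‖a‖ < 1) (hne : s ≠ 0) :
    ‖(s.map fun a ↦ (X - C a : ℂ_[p][X]).eval 0).prod‖ < 1 := by
  obtain ⟨a, ha⟩ := Multiset.exists_mem_of_ne_zero hne
  obtain ⟨t, rfl⟩ := Multiset.exists_cons_of_mem ha
  rw [Multiset.map_cons, Multiset.prod_cons, norm_mul]
  have ha : ‖(X - C a : ℂ_[p][X]).eval 0‖ < 1 := by
    rw [eval_sub, eval_X, eval_C, zero_sub, norm_neg]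
    exact hs a (Multiset.mem_cons_self a t)
  have ht := norm_prod_eval_zero_le_one t (fun b hb ↦ hs b (Multiset.mem_cons_of_mem hb))
  calc ‖(X - C a : ℂ_[p][X]).eval 0‖ * ‖(t.map fun a ↦ (X - C a : ℂ_[p][X]).eval 0).prod‖
      ≤ ‖(X - C a : ℂ_[p][X]).eval 0‖ * 1 := by gcongr
    _ < 1 := by rw [mul_one]; exact ha

/-- For a MONIC polynomial over `ℂ_p` of positive degree with all roots in the open unit disc, the constant
term has norm `< 1` (it is `±` the product of the roots; `ℂ_p` is algebraically closed). [folklore] -/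
theorem norm_eval_zero_lt_one_of_roots {Q : ℂ_[p][X]} (hQ : Q.Monic) (hdeg : 0 < Q.natDegree)
    (hr : ∀ α, Q.IsRoot α → ‖α‖ < 1) : ‖Q.eval 0‖ < 1 := by
  have hsplit : Q.Splits := IsAlgClosed.splits Q
  have hprod := hsplit.eq_prod_roots_of_monic hQ
  have hcard : Q.roots.card = Q.natDegree := hsplit.natDegree_eq_card_roots.symm
  have hne : Q.roots ≠ 0 := by
    intro h
    rw [h, Multiset.card_zero] at hcard
    omega
  rw [hprod, eval_multiset_prod, Multiset.map_map]
  exact norm_prod_eval_zero_lt_one (fun a ha ↦ hr a ((mem_roots hQ.ne_zero).mp ha)) hne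

/-- `Φ = (1+X)^p − 1` has `natDegree p`. [folklore] -/
theorem natDegree_powerMap : ((1 + X : ℂ_[p][X]) ^ p - 1).natDegree = p := by
  have h1 : (1 + X : ℂ_[p][X]) = X + C 1 := by rw [add_comm, map_one]
  rw [h1, ← map_one (C : ℂ_[p] →+* ℂ_[p][X]), natDegree_sub_C, (monic_X_add_C (1 : ℂ_[p])).natDegree_pow,
    natDegree_X_add_C, mul_one]

/-- `Φ ≠ 0`. [folklore] -/
theorem powerMap_ne_zero : ((1 + X : ℂ_[p][X]) ^ p - 1) ≠ 0 := by
  intro h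
  have := natDegree_powerMap (p := p)
  rw [h, natDegree_zero] at this
  exact hp.out.ne_zero this.symm

/-- `Φ` is not a constant. [folklore] -/
theorem powerMap_ne_C (c : ℂ_[p]) : ((1 + X : ℂ_[p][X]) ^ p - 1) ≠ C c := by
  intro h
  have := natDegree_powerMap (p := p)
  rw [h, natDegree_C] at this
  exact hp.out.ne_zero this.symm

/-- `Q(Φ) ≠ 0` for `Q ≠ 0`. [folklore] -/
theorem comp_powerMap_ne_zero {Q : ℂ_[p][X]} (hQ : Q ≠ 0) :
    Q.comp ((1 + X : ℂ_[p][X]) ^ p - 1) ≠ 0 := by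
  intro h
  rcases (comp_eq_zero_iff.mp h) with h0 | ⟨-, hC⟩
  · exact hQ h0
  · exact powerMap_ne_C _ hC

/-- `rootMultiplicity a (Q^n) = n * rootMultiplicity a Q` for `Q ≠ 0`. [folklore] -/
theorem rootMultiplicity_pow' {Q : ℂ_[p][X]} (hQ : Q ≠ 0) (a : ℂ_[p]) (n : ℕ) :
    rootMultiplicity a (Q ^ n) = n * rootMultiplicity a Q := by
  induction n with
  | zero => simp
  | succ k ih =>
    rw [pow_succ, rootMultiplicity_mul (mul_ne_zero (pow_ne_zero _ hQ) hQ), ih]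
    ring

/-- **Step 0 of the rigidity: the multiplicities of the root `0` agree.** From
`Q₂(Φ)·Q₁^p = Q₂^p·Q₁(Φ)` with `Q₁, Q₂ ≠ 0`: taking `rootMultiplicity 0` (additive on products, unchanged by
`Q ↦ Q(Φ)`) gives `m₂ + p·m₁ = p·m₂ + m₁`, whence `m₁ = m₂` as `p ≥ 2`. [folklore] -/
theorem rootMultiplicity_zero_eq_of_identity {Q₁ Q₂ : ℂ_[p][X]} (hQ₁ : Q₁ ≠ 0) (hQ₂ : Q₂ ≠ 0)
    (hid : Q₂.comp ((1 + X : ℂ_[p][X]) ^ p - 1) * Q₁ ^ p =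
      Q₂ ^ p * Q₁.comp ((1 + X : ℂ_[p][X]) ^ p - 1)) :
    rootMultiplicity 0 Q₁ = rootMultiplicity 0 Q₂ := by
  have hp2 : 2 ≤ p := hp.out.two_le
  have hL : rootMultiplicity 0 (Q₂.comp ((1 + X : ℂ_[p][X]) ^ p - 1) * Q₁ ^ p) =
      rootMultiplicity 0 Q₂ + p * rootMultiplicity 0 Q₁ := by
    rw [rootMultiplicity_mul (mul_ne_zero (comp_powerMap_ne_zero hQ₂) (pow_ne_zero _ hQ₁)),
      rootMultiplicity_zero_comp_powerMap hQ₂, rootMultiplicity_pow' hQ₁]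
  have hR : rootMultiplicity 0 (Q₂ ^ p * Q₁.comp ((1 + X : ℂ_[p][X]) ^ p - 1)) =
      p * rootMultiplicity 0 Q₂ + rootMultiplicity 0 Q₁ := by
    rw [rootMultiplicity_mul (mul_ne_zero (pow_ne_zero _ hQ₂) (comp_powerMap_ne_zero hQ₁)),
      rootMultiplicity_pow' hQ₂, rootMultiplicity_zero_comp_powerMap hQ₁]
  have h := congrArg (rootMultiplicity (0 : ℂ_[p])) hid
  rw [hL, hR] at h
  -- `m₂ + p m₁ = p m₂ + m₁` with `p ≥ 2`
  set a := rootMultiplicity 0 Q₁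
  set b := rootMultiplicity 0 Q₂
  have h' : ((p : ℤ) - 1) * ((a : ℤ) - b) = 0 := by
    have hz : (b : ℤ) + p * a = p * b + a := by exact_mod_cast h
    linear_combination hz
  rcases mul_eq_zero.mp h' with h1 | h1
  · exfalso
    have : (p : ℤ) = 1 := by linarith
    have : p = 1 := by exact_mod_cast this
    omega
  · exact_mod_cast (sub_eq_zero.mp h1)

end Summit.BirchSwinnertonDyer.BirchSwinnertonDyer.Theorems.CongruentShaFreeCutPowerMapPolynomialRigidity

end
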